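import Literature.Probability.RandomPlanarGeometry.SLEKappaRhoAssembly
import Literature.Probability.RandomPlanarGeometry.SLEKappaRhoBesselEquation
import Literature.Probability.RandomPlanarGeometry.SLEKappaRhoDriving
import Literature.Probability.RandomPlanarGeometry.SLEDriftedDrivingProofs
import HarnessLib

/-!
# [LSW] Lemma 8.3 (2), positive axis, discharged: no positive real point is swallowed by SLE(κ, ρ), `κ ≤ 4`

Proof-only complement to `SLEKappaRhoAssembly` (no definitions, no named facts): the named fact
`Literature.Probability.RandomPlanarGeometry.SLEKappaRho.swallowingTime_ofReal_pos` of that file,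

* G. F. Lawler, O. Schramm, W. Werner, *Conformal restriction: the chordal case*, J. Amer. Math.
  Soc. **16** (2003) 917–955, arXiv:math/0209343 (**[LSW]**), Lemma 8.3 (2)–(3) and their proof
  (p. 36): for `κ ≤ 4`, `ρ > −2` and the hulls of SLE(κ, ρ), "a.s. `1 ∉ K_t` for all `t ≥ 0`
  […] Scale invariance then implies `K_∞ ∩ (0, ∞) = ∅` a.s.",

is PROVED here (`SLEKappaRho.swallowingTime_ofReal_pos_holds`): for `0 < κ ≤ 4`, `ρ > −2` and
every SLE(κ, ρ) driving pair `(O, W)` of the tree (`IsSLEKappaRhoPair`), almost surely no real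
`x > 0` is swallowed by the Loewner chain of `t ↦ W_t(ω)` (`Loewner.swallowingTime … x = ⊤`).

## The printed proof and its formalisation

[LSW] p. 36: "Set `x_t = g_t(1)` for `t < τ_1` and observe that `x_t − O_t` is monotone
increasing. In particular, `x_t − O_t ≥ 1`, `t < τ_1`. On the set of times `t < τ_1` such that
`x_t − W_t < 1/2`, we therefore have `dW_t ≤ 2|ρ| dt + √κ dB_t`. Setting `x̃_t = x_t − W_t`, we
get `dx̃_t ≥ −2|ρ| dt − √κ dB_t + (2/x̃_t) dt` on the set of times `t` such that `x̃_t < 1/2`.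
[…] for any finite fixed `t_0 > 0` and any `c ∈ ℝ` the law of the process `(B_t + ct, t ≤ t_0)`
is equicontinuous with the law of `(B_t, t ≤ t_0)` […] Therefore, also in this case `x̃_t` never
hits `0` and `τ_1 = ∞`. […] Scale invariance then implies `K_∞ ∩ (0, ∞) = ∅` a.s."

The stochastic input — no positive real point is swallowed by the chain driven by the Brownian
motion WITH DRIFT `√κ B_t + c t`, `κ ≤ 4` — is the tree's theorem
`sle_drift_swallowingTime_ofReal_eq_top_holds` (`SLEDriftedDrivingProofs`; [LSW] obtain it from
the Cameron–Martin equivalence of laws, the tree by Lawler's optional stopping argument), in its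
Markov-shifted form `ae_forall_swallowingTime_shift_add_mul_eq_top` (`SLEDriftedDriving`): for
every `q ≥ 0`, a.s. no `a > 0` is swallowed by `s ↦ √κ (B_{q+s} − B_q) + c s`. The comparison
"`dx̃_t ≥ …`" is carried out here path by path, deterministically:

* `Loewner.realFlow_le_realFlow_of_monotoneOn_sub` — **comparison of real Loewner flows**: for
  continuous driving functions `U`, `V` from `0` whose difference `V − U` is non-decreasing on
  `[0, τ)`, and a point `a > 0` alive under both, the gap `re g_s(a) − V_s` of the `V`-flow is at
  most the gap `re g_s(a) − U_s` of the `U`-flow for `s < τ` (the difference of the two flow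
  points has derivative `2/α − 2/β`, so the first time the gaps `α`, `β` would cross is
  contradictory; cf. `Loewner.realFlow_sub_realFlow_mono`);
* `Loewner.realFlow_not_tendsto_zero_of_comparison` — hence if `a` is alive under `V` up to and
  including time `τ`, the `U`-gap cannot tend to `0` at `τ−` (it stays above the minimum of the
  continuous positive `V`-gap on `[0, τ]`);
* `Loewner.realFlow_shift_sub` — **restarting the flow at time `q`** (the cocycle
  `g_{q+s} = g^{W(q+·)}_s ∘ g_q`, `Loewner.map_add`, with translation covariance
  `Loewner.IsSolution.add_const`, `Loewner.swallowingTime_add_const`): the gap of `x` at time `q + s`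
  is the gap at time `s` of the point `re g_q(x) − W_q` under the increment driver
  `s ↦ W_{q+s} − W_q`;
* `Loewner.swallowingTime_eq_top_of_drift_comparison` — **the pathwise core**: for a continuous
  path `w` from `0` with `w_t = √κ β_t + ρ ∫₀ᵗ du/z_u`, `z = w − o ≥ 0` … (precisely: `o ≤ 0`,
  `1/(w − o)` locally integrable), such that no positive point is swallowed by any of the drifted
  increment drivers `s ↦ √κ (β_{q+s} − β_q) + c s`, `q ∈ ℚ ∩ [0, ∞)`, `c = 2 max(ρ, 0)/x`, the
  point `x` is never swallowed by `w`. Indeed, if `T_x = b < ∞`, the gap `Y_t = re g_t(x) − w_t`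
  (continuous, `Y_0 = x`, `Y_b = 0`: `Loewner.continuous_realFlowStop`) is `< x/2` after its last
  visit `t₁ < b` to `[x/2, ∞)`; for a rational `q ∈ (t₁, b)` and `u ∈ [q, b)` one has
  `z_u = (re g_u(x) − o_u) − Y_u ≥ x − Y_u > x/2` ([LSW]'s "`x_t − O_t ≥ 1`": `re g_u(x) ≥ x`,
  `Loewner.re_map_mono`, and `o ≤ 0`), so the increments of `ρ ∫ du/z_u` after `q` are at most
  `c` times the elapsed time ([LSW]'s "`dW_t ≤ 2|ρ| dt + √κ dB_t`"), i.e. `V − U` is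
  non-decreasing for the increment driver `U` of `w` and the drifted increment driver `V` of
  `√κ β` at `q`; but the `U`-gap of `a = Y_q > 0` is `Y_{q+s} → 0` as `s ↑ b − q` while `a` is
  never swallowed by `V` — contradicting the comparison;
* `SLEKappaRho.swallowingTime_ofReal_pos_holds` — the assembly: almost every sample path of an
  SLE(κ, ρ) driving pair satisfies the hypotheses of the core (`W` continuous and
  `∫₀ᵗ du/Z_u < ∞`, `W_t = √κ B_t + ρ ∫₀ᵗ du/Z_u`: `SLEKappaRho.integral_inv_eq_holds`,
  `IsSLEKappaRhoPair.ae_continuous`, `SLEKappaRho.ae_snd_eq_of`; `O ≤ 0` and `W_0 = 0` hold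
  everywhere; the drifted non-swallowing at the countably many rational shifts), for each level
  `x = 1/(n+1)`, whence for all `x > 0` by monotonicity of `T_x` in `x`
  (`Loewner.forall_swallowingTime_eq_top_of_seq`; [LSW]: "scale invariance").

## References

* G. F. Lawler, O. Schramm, W. Werner, *Conformal restriction: the chordal case*, J. Amer. Math.
  Soc. 16 (2003), 917–955, §8.3, Lemma 8.3 and its proof (arXiv math/0209343, p. 36).
* G. F. Lawler, *Conformally Invariant Processes in the Plane*, AMS (2005), §4.1 (the flow of
  real points, `T_x`), Rem. 4.9 (the cocycle), Prop. 6.8.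
-/

noncomputable section

open MeasureTheory Filter Set Complex Topology
open scoped NNReal ENNReal

namespace Literature.Probability.RandomPlanarGeometry

namespace Loewner

variable {U V W : ℝ≥0 → ℝ}

/-! ### Comparison of the real flows of two driving functions -/

/-- **Comparison of real Loewner flows.** Let `U`, `V` be continuous driving functions with
`U 0 = V 0 = 0` whose difference `V − U` is non-decreasing on `[0, τ)`, and let `a > 0` be alive
at all times `s < τ` under both chains. Then for `s < τ` the gap of the `V`-flow is at most the
gap of the `U`-flow: `re g^V_s(a) − V_s ≤ re g^U_s(a) − U_s`. (With `α`, `β` the two gaps,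
`α − β = (re g^U(a) − re g^V(a)) + (V − U)`; the first summand has derivative `2/α − 2/β`, which
is positive where `α < β`, and the second is non-decreasing, so after the last time `u₀ ≤ s` with
`β ≤ α` the difference `α − β` cannot become negative.) This is the deterministic content of
"`dx̃_t ≥ −2|ρ| dt − √κ dB_t + (2/x̃_t) dt` … by comparing" in the proof of [LSW] Lemma 8.3.
[cite: LawlerSchrammWerner2003Restriction, proof of Lemma 8.3 (p. 36)] -/
theorem realFlow_le_realFlow_of_monotoneOn_sub (hU : Continuous U) (hV : Continuous V)
    (hU0 : U 0 = 0) (hV0 : V 0 = 0) {a : ℝ} (ha : 0 < a) {τ : ℝ≥0}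
    (hτU : ∀ s : ℝ≥0, s < τ → (s : WithTop ℝ≥0) < swallowingTime U a)
    (hτV : ∀ s : ℝ≥0, s < τ → (s : WithTop ℝ≥0) < swallowingTime V a)
    (hD : MonotoneOn (fun s : ℝ≥0 ↦ V s - U s) (Iio τ)) {s : ℝ≥0} (hs : s < τ) :
    realFlow V a s ≤ realFlow U a s := by
  have haU : U 0 < a := by rwa [hU0]
  have haV : V 0 < a := by rwa [hV0]
  have haU' : (a : ℂ) ≠ U 0 := fun h ↦ haU.ne' (by exact_mod_cast h)
  have haV' : (a : ℂ) ≠ V 0 := fun h ↦ haV.ne' (by exact_mod_cast h)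
  obtain ⟨g, hg⟩ := exists_isSolution_swallowingTime_holds hU haU'
  obtain ⟨g', hg'⟩ := exists_isSolution_swallowingTime_holds hV haV'
  have hsU := hτU s hs
  have hsV := hτV s hs
  have hsU' : (((s : ℝ)).toNNReal : WithTop ℝ≥0) < swallowingTime U a := by simpa using hsU
  have hsV' : (((s : ℝ)).toNNReal : WithTop ℝ≥0) < swallowingTime V a := by simpa using hsV
  have hsubU := Icc_subset_timeDomain hsU'
  have hsubV := Icc_subset_timeDomain hsV'
  -- the two gaps as functions of real time
  set α : ℝ → ℝ := fun u ↦ (g u).re - U u.toNNReal with hα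
  set β : ℝ → ℝ := fun u ↦ (g' u).re - V u.toNNReal with hβ
  have hgc : ContinuousOn (fun u ↦ (g u).re) (Icc 0 s) :=
    continuous_re.comp_continuousOn (hg.continuousOn.mono hsubU)
  have hg'c : ContinuousOn (fun u ↦ (g' u).re) (Icc 0 s) :=
    continuous_re.comp_continuousOn (hg'.continuousOn.mono hsubV)
  have hαc : ContinuousOn α (Icc 0 s) := hgc.sub (hU.comp continuous_real_toNNReal).continuousOn
  have hβc : ContinuousOn β (Icc 0 s) := hg'c.sub (hV.comp continuous_real_toNNReal).continuousOn
  have hαpos : ∀ u ∈ Icc (0 : ℝ) s, 0 < α u := fun u hu ↦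
    sub_pos.2 (hg.driving_lt_re hU haU hu.1 (hsubU hu).2)
  have hβpos : ∀ u ∈ Icc (0 : ℝ) s, 0 < β u := fun u hu ↦
    sub_pos.2 (hg'.driving_lt_re hV haV hu.1 (hsubV hu).2)
  -- the claim is `β s ≤ α s`
  have hgoal : realFlow V a s = β s ∧ realFlow U a s = α s := by
    rw [realFlow_eq_re_sub hU hg hsU, realFlow_eq_re_sub hV hg' hsV]
    simp [hα, hβ, Real.toNNReal_coe]
  rw [hgoal.1, hgoal.2]
  by_contra hlt
  rw [not_le] at hlt
  -- the last time `u₀ ≤ s` at which `β ≤ α`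
  set A : Set ℝ := Icc 0 (s : ℝ) ∩ (fun u ↦ α u - β u) ⁻¹' Ici 0 with hA
  have hAc : IsClosed A := (hαc.sub hβc).preimage_isClosed_of_isClosed isClosed_Icc isClosed_Ici
  have hA0 : (0 : ℝ) ∈ A := by
    refine ⟨⟨le_rfl, s.coe_nonneg⟩, ?_⟩
    show 0 ≤ α 0 - β 0
    simp [hα, hβ, hg.apply_zero, hg'.apply_zero, hU0, hV0]
  have hAbdd : BddAbove A := ⟨s, fun u hu ↦ hu.1.2⟩
  set u₀ : ℝ := sSup A with hu₀
  have hu₀A : u₀ ∈ A := hAc.csSup_mem ⟨0, hA0⟩ hAbdd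
  have hu₀0 : 0 ≤ u₀ := hu₀A.1.1
  have hu₀ge : 0 ≤ α u₀ - β u₀ := hu₀A.2
  have hu₀s : u₀ < s := by
    refine lt_of_le_of_ne hu₀A.1.2 fun h ↦ ?_
    rw [h] at hu₀ge
    linarith
  -- after `u₀`, `α < β`
  have hafter : ∀ u, u₀ < u → u ≤ s → α u < β u := by
    intro u hu hus
    by_contra h
    have huA : u ∈ A := ⟨⟨hu₀0.trans hu.le, hus⟩, by
      show 0 ≤ α u - β u
      linarith [not_lt.1 h]⟩
    exact absurd (le_csSup hAbdd huA) (not_le.2 hu)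
  -- `φ = re g − re g'` is non-decreasing on `[u₀, s]`
  set φ : ℝ → ℝ := fun u ↦ (g u).re - (g' u).re with hφ
  have hφc : ContinuousOn φ (Icc u₀ s) := (hgc.sub hg'c).mono (Icc_subset_Icc_left hu₀0)
  have hφm : MonotoneOn φ (Icc u₀ s) := by
    refine monotoneOn_of_hasDerivWithinAt_nonneg (convex_Icc u₀ (s : ℝ)) hφc
      (f' := fun u ↦ 2 / α u - 2 / β u) ?_ ?_
    · intro u hu
      rw [interior_Icc] at hu ⊢
      have hu0 : 0 < u := hu₀0.trans_lt hu.1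
      have huU : (u.toNNReal : WithTop ℝ≥0) < swallowingTime U a := (hsubU ⟨hu0.le, hu.2.le⟩).2
      have huV : (u.toNNReal : WithTop ℝ≥0) < swallowingTime V a := (hsubV ⟨hu0.le, hu.2.le⟩).2
      exact ((hg.hasDerivAt_re hu0 huU).sub (hg'.hasDerivAt_re hu0 huV)).hasDerivWithinAt
    · intro u hu
      rw [interior_Icc] at hu
      have hu0 : 0 < u := hu₀0.trans_lt hu.1
      have hαu := hαpos u ⟨hu0.le, hu.2.le⟩
      have hlt' := hafter u hu.1 hu.2.le
      have : 2 / β u ≤ 2 / α u := div_le_div_of_nonneg_left zero_le_two hαu hlt'.le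
      linarith
  have h1 : φ u₀ ≤ φ s := hφm ⟨le_rfl, hu₀s.le⟩ ⟨hu₀s.le, le_rfl⟩ hu₀s.le
  -- `V − U` is non-decreasing
  have h2 : V u₀.toNNReal - U u₀.toNNReal ≤ V s - U s := by
    have hu₀s' : u₀.toNNReal ≤ s := Real.toNNReal_le_iff_le_coe.2 hu₀s.le
    exact hD (show u₀.toNNReal ∈ Iio τ from lt_of_le_of_lt hu₀s' hs) (show s ∈ Iio τ from hs) hu₀s'
  -- `α − β = φ + (V − U)`
  have h3 : α u₀ - β u₀ = φ u₀ + (V u₀.toNNReal - U u₀.toNNReal) := by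
    simp only [hα, hβ, hφ]
    ring
  have h4 : α s - β s = φ s + (V s - U s) := by
    simp only [hα, hβ, hφ, Real.toNNReal_coe]
    ring
  linarith

/-- **The gap of the dominated flow cannot tend to `0`.** In the situation of
`realFlow_le_realFlow_of_monotoneOn_sub` with `τ > 0`, if moreover `a` is alive under `V` at
time `τ` itself, then the gap `re g^U_s(a) − U_s` does not tend to `0` as `s ↑ τ`: it stays above
the minimum over `[0, τ]` of the continuous positive frozen gap of the `V`-flow
(`continuous_realFlowStop`). In particular `a` is not swallowed by `U` at time `τ`. This is
"Therefore, also in this case `x̃_t` never hits `0`" of the proof of [LSW] Lemma 8.3.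
[cite: LawlerSchrammWerner2003Restriction, proof of Lemma 8.3 (p. 36)] -/
theorem realFlow_not_tendsto_zero_of_comparison (hU : Continuous U) (hV : Continuous V)
    (hU0 : U 0 = 0) (hV0 : V 0 = 0) {a : ℝ} (ha : 0 < a) {τ : ℝ≥0} (hτ : 0 < τ)
    (hτU : ∀ s : ℝ≥0, s < τ → (s : WithTop ℝ≥0) < swallowingTime U a)
    (hτV : (τ : WithTop ℝ≥0) < swallowingTime V a)
    (hD : MonotoneOn (fun s : ℝ≥0 ↦ V s - U s) (Iio τ))
    (hlim : Tendsto (fun s ↦ realFlow U a s) (𝓝[<] τ) (𝓝 0)) : False := by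
  have haV : V 0 < a := by rwa [hV0]
  have hβc : Continuous (realFlowStop V a) := continuous_realFlowStop hV haV
  obtain ⟨s₀, hs₀, hmin⟩ :=
    isCompact_Icc.exists_isMinOn (nonempty_Icc.2 zero_le) hβc.continuousOn
  have hs₀V : (s₀ : WithTop ℝ≥0) < swallowingTime V a :=
    lt_of_le_of_lt (WithTop.coe_le_coe.2 hs₀.2) hτV
  have hδ : 0 < realFlowStop V a s₀ := (realFlowStop_pos_iff hV haV).2 hs₀V
  have hτV' : ∀ s : ℝ≥0, s < τ → (s : WithTop ℝ≥0) < swallowingTime V a := fun s hs ↦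
    lt_trans (WithTop.coe_lt_coe.2 hs) hτV
  -- for `s < τ` the `U`-gap is at least the minimum of the `V`-gap
  have hge : ∀ s : ℝ≥0, s < τ → realFlowStop V a s₀ ≤ realFlow U a s := by
    intro s hs
    have h1 : realFlowStop V a s₀ ≤ realFlowStop V a s := hmin ⟨zero_le, hs.le⟩
    rw [realFlowStop_of_lt (hτV' s hs)] at h1
    exact h1.trans (realFlow_le_realFlow_of_monotoneOn_sub hU hV hU0 hV0 ha hτU hτV' hD hs)
  -- but the `U`-gap tends to `0`
  haveI : (𝓝[<] τ).NeBot := nhdsLT_neBot_of_exists_lt ⟨0, hτ⟩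
  have hev : ∀ᶠ s in 𝓝[<] τ, realFlow U a s < realFlowStop V a s₀ := hlim (Iio_mem_nhds hδ)
  obtain ⟨s, hs1, hs2⟩ := (hev.and self_mem_nhdsWithin).exists
  exact absurd (hge s hs2) (not_le.2 hs1)

/-! ### Restarting the real flow at a later time -/

/-- **The real flow restarted at time `q`** (the cocycle `g_{q+s} = g^{W(q+·)}_s ∘ g_q`,
`Loewner.map_add`, in the coordinates of the increment driver `s ↦ W_{q+s} − W_q`, by the
translation covariance `Loewner.IsSolution.add_const` / `Loewner.swallowingTime_add_const`): if `x` is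
alive at time `q + s`, then the point `re g_q(x) − W_q` is alive at time `s` under the increment
driver and its gap there is the gap of `x` at time `q + s`:
`realFlow (W_{q+·} − W_q) (re g_q(x) − W_q) s = realFlow W x (q + s)`. Lawler (2005), Rem. 4.9.
[cite: Lawler2005, Rem. 4.9] -/
theorem realFlow_shift_sub (hW : Continuous W) {x : ℝ} (q s : ℝ≥0)
    (h : ((q + s : ℝ≥0) : WithTop ℝ≥0) < swallowingTime W x) :
    (s : WithTop ℝ≥0) < swallowingTime (fun u ↦ W (q + u) - W q) ((realFlow W x q : ℝ) : ℂ) ∧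
      realFlow (fun u ↦ W (q + u) - W q) (realFlow W x q) s = realFlow W x (q + s) := by
  have hq : (q : WithTop ℝ≥0) < swallowingTime W x :=
    lt_of_le_of_lt (by exact_mod_cast (le_self_add : q ≤ q + s)) h
  have hx : (x : ℂ) ≠ W 0 := ne_driving_of_lt_swallowingTime hq
  obtain ⟨g, hg⟩ := exists_isSolution_swallowingTime_holds hW hx
  -- `g_q(x)` is real
  have him : (map W q x).im = 0 := by
    rw [map_eq_of_isSolution hW hg hq]
    exact IsSolution.im_eq_zero_holds hg (ofReal_im x) q q.coe_nonneg (by simpa using hq)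
  have ha : ((realFlow W x q : ℝ) : ℂ) = map W q x + ((-W q : ℝ) : ℂ) := by
    apply Complex.ext
    · simp [realFlow, sub_eq_add_neg]
    · simp [realFlow, him]
  have hfun : (fun u ↦ W (q + u) - W q) = fun u ↦ W (q + u) + (-W q) := by
    funext u
    ring
  obtain ⟨h1, h2⟩ := map_add hW h
  have hT : swallowingTime (fun u ↦ W (q + u) - W q) ((realFlow W x q : ℝ) : ℂ) =
      swallowingTime (fun u ↦ W (q + u)) (map W q x) := by
    rw [hfun, ha]
    exact swallowingTime_add_const (fun u ↦ W (q + u)) (map W q x) (-W q)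
  refine ⟨by rw [hT]; exact h1, ?_⟩
  -- translation covariance of the Loewner map (`IsSolution.add_const`)
  obtain ⟨G, hG⟩ := exists_isSolution_swallowingTime_holds (continuous_shift W hW q)
    (ne_driving_of_lt_swallowingTime h1)
  have hG' : IsSolution (fun u ↦ W (q + u) + -W q) (map W q x + ((-W q : ℝ) : ℂ))
      (fun t ↦ G t + ((-W q : ℝ) : ℂ)) (swallowingTime (fun u ↦ W (q + u)) (map W q x)) :=
    hG.add_const (-W q)
  have hWc : Continuous fun u ↦ W (q + u) + -W q := (continuous_shift W hW q).add continuous_const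
  have key : map (fun u ↦ W (q + u) - W q) s ((realFlow W x q : ℝ) : ℂ) =
      map W (q + s) x + ((-W q : ℝ) : ℂ) := by
    rw [hfun, ha, h2, map_eq_of_isSolution (continuous_shift W hW q) hG h1,
      map_eq_of_isSolution hWc hG' h1]
  show (map (fun u ↦ W (q + u) - W q) s ((realFlow W x q : ℝ) : ℂ)).re - (W (q + s) - W q) =
    (map W (q + s) x).re - W (q + s)
  rw [key]
  simp only [add_re, ofReal_re]
  ring

/-! ### The pathwise core of [LSW] Lemma 8.3 (2) -/

/-- **No positive real point is swallowed: the pathwise core of [LSW] Lemma 8.3 (2).** Let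
`w : ℝ≥0 → ℝ` be a continuous driving function with `w 0 = 0` which, for a continuous path `β`,
a path `o ≤ 0`, reals `κ`, `ρ` and the locally integrable function `u ↦ 1/(w_u − o_u)`, satisfies
`w_t = √κ β_t + ρ ∫₀ᵗ du/(w_u − o_u)` for all `t` (for an SLE(κ, ρ) sample path: `β = B`,
`o = O ≤ 0`, `w − o = Z`, [LSW] §8.3). Let `x > 0` and `c = 2 max(ρ, 0)/x`, and suppose that
for every rational `q ≥ 0` no positive real point is swallowed by the drifted increment driver
`s ↦ √κ (β_{q+s} − β_q) + c s`. Then `x` is not swallowed by `w`: `T_x = ⊤`.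
Proof ([LSW] p. 36, made pathwise): if `T_x = b < ∞`, the gap `Y_t = re g_t(x) − w_t` is
continuous with `Y_0 = x`, `Y_b = 0`; after its last visit `t₁ < b` to `[x/2, ∞)` pick a
rational `q ∈ (t₁, b)`. For `u ∈ [q, b)`, `w_u − o_u ≥ x − Y_u > x/2` ("`x_t − O_t ≥ 1`":
`re g_u(x) ≥ x` and `o ≤ 0`), so after time `q` the drift `ρ ∫ du/(w − o)` grows at most at
rate `c` ("`dW_t ≤ 2|ρ| dt + √κ dB_t`"): the difference of the drifted increment driver `V` of
`√κ β` and the increment driver `U` of `w` at `q` is non-decreasing on `[0, b − q)`. The gap of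
`a = Y_q > 0` under `U` is `Y_{q+s}` (`realFlow_shift_sub`), which tends to `0` as `s ↑ b − q`,
while `a` is never swallowed by `V`: this contradicts `realFlow_not_tendsto_zero_of_comparison`.
[cite: LawlerSchrammWerner2003Restriction, proof of Lemma 8.3 (p. 36)] -/
theorem swallowingTime_eq_top_of_drift_comparison {w o β : ℝ≥0 → ℝ} (hw : Continuous w)
    (hw0 : w 0 = 0) (hβ : Continuous β) (ho : ∀ t, o t ≤ 0) {κ ρ x : ℝ} (hx : 0 < x)
    (hint : ∀ t : ℝ≥0, IntervalIntegrable (fun u : ℝ ↦ (w u.toNNReal - o u.toNNReal)⁻¹) volume 0 t)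
    (hweq : ∀ t : ℝ≥0, w t = Real.sqrt κ * β t +
      ρ * ∫ u in (0 : ℝ)..(t : ℝ), (w u.toNNReal - o u.toNNReal)⁻¹)
    (hdrift : ∀ q : ℚ, 0 ≤ (q : ℝ) → ∀ a : ℝ, 0 < a →
      swallowingTime (fun s : ℝ≥0 ↦ Real.sqrt κ * β (((q : ℝ)).toNNReal + s) -
        Real.sqrt κ * β ((q : ℝ)).toNNReal + 2 * max ρ 0 / x * (s : ℝ)) a = ⊤) :
    swallowingTime w x = ⊤ := by
  by_contra hT
  obtain ⟨b, hb⟩ := WithTop.ne_top_iff_exists.1 hT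
  have hx0 : w 0 < x := by rwa [hw0]
  have hx' : (x : ℂ) ≠ w 0 := fun h ↦ hx0.ne' (by exact_mod_cast h)
  -- the frozen gap `Y`
  set Y : ℝ≥0 → ℝ := realFlowStop w x with hY
  have hYc : Continuous Y := continuous_realFlowStop hw hx0
  have hY0 : Y 0 = x := by rw [hY, realFlowStop_zero hw hx0, hw0, sub_zero]
  have hYb : Y b = 0 := realFlowStop_of_le (by rw [← hb])
  have hYpos : ∀ t : ℝ≥0, t < b → 0 < Y t := fun t ht ↦
    (realFlowStop_pos_iff hw hx0).2 (by rw [← hb]; exact_mod_cast ht)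
  -- the last visit `t₁ < b` of `Y` to `[x/2, ∞)`
  set A : Set ℝ≥0 := {t | t ≤ b} ∩ {t | x / 2 ≤ Y t} with hA
  have hAc : IsClosed A :=
    (isClosed_le continuous_id continuous_const).inter (isClosed_le continuous_const hYc)
  have hA0 : (0 : ℝ≥0) ∈ A := ⟨show (0 : ℝ≥0) ≤ b from zero_le, by show x / 2 ≤ Y 0; rw [hY0]; linarith⟩
  have hAbdd : BddAbove A := ⟨b, fun t ht ↦ ht.1⟩
  set t₁ : ℝ≥0 := sSup A with ht₁
  have ht₁A : t₁ ∈ A := hAc.csSup_mem ⟨0, hA0⟩ hAbdd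
  have ht₁b : t₁ < b := by
    refine lt_of_le_of_ne ht₁A.1 fun h ↦ ?_
    have h2 : x / 2 ≤ Y t₁ := ht₁A.2
    rw [h, hYb] at h2
    linarith
  have hsmall : ∀ t : ℝ≥0, t₁ < t → t ≤ b → Y t < x / 2 := by
    intro t ht htb
    by_contra hge
    exact absurd (le_csSup hAbdd ⟨htb, not_lt.1 hge⟩) (not_le.2 ht)
  -- a rational time `q ∈ (t₁, b)`
  obtain ⟨q, hq₁, hq₂⟩ := exists_rat_btwn (NNReal.coe_lt_coe.2 ht₁b)
  have hq0 : (0 : ℝ) ≤ q := t₁.coe_nonneg.trans hq₁.le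
  set q' : ℝ≥0 := ((q : ℝ)).toNNReal with hq'
  have hq'coe : (q' : ℝ) = q := Real.coe_toNNReal _ hq0
  have ht₁q : t₁ < q' := by rw [← NNReal.coe_lt_coe, hq'coe]; exact hq₁
  have hqb : q' < b := by rw [← NNReal.coe_lt_coe, hq'coe]; exact hq₂
  have hq'T : (q' : WithTop ℝ≥0) < swallowingTime w x := by rw [← hb]; exact_mod_cast hqb
  -- the horizon `τ₀ = b − q'` of the comparison
  set τ₀ : ℝ≥0 := b - q' with hτ₀
  have hτ₀pos : 0 < τ₀ := tsub_pos_of_lt hqb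
  have hqs : ∀ s : ℝ≥0, s < τ₀ → q' + s < b := fun s hs ↦ lt_tsub_iff_left.1 hs
  have hqsT : ∀ s : ℝ≥0, s < τ₀ → ((q' + s : ℝ≥0) : WithTop ℝ≥0) < swallowingTime w x :=
    fun s hs ↦ by rw [← hb]; exact_mod_cast hqs s hs
  -- the restarted point `a = Y_{q'} > 0` and the two drivers
  set a : ℝ := Y q' with ha
  have hapos : 0 < a := hYpos q' hqb
  have haq : a = realFlow w x q' := by rw [ha, hY, realFlowStop_of_lt hq'T]
  set U : ℝ≥0 → ℝ := fun u ↦ w (q' + u) - w q' with hU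
  set V : ℝ≥0 → ℝ := fun u ↦ Real.sqrt κ * β (q' + u) - Real.sqrt κ * β q' +
    2 * max ρ 0 / x * (u : ℝ) with hV
  have hUc : Continuous U := (continuous_shift w hw q').sub continuous_const
  have hVc : Continuous V :=
    ((continuous_const.mul (continuous_shift β hβ q')).sub continuous_const).add
      (continuous_const.mul NNReal.continuous_coe)
  have hU0 : U 0 = 0 := by simp [hU]
  have hV0 : V 0 = 0 := by simp [hV]
  have hVtop : swallowingTime V a = ⊤ := hdrift q hq0 a hapos
  -- the cocycle: `a` is alive under `U` before `τ₀`, with gap `Y_{q'+s}`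
  have hcoc : ∀ s : ℝ≥0, s < τ₀ →
      (s : WithTop ℝ≥0) < swallowingTime U a ∧ realFlow U a s = Y (q' + s) := by
    intro s hs
    obtain ⟨h1, h2⟩ := realFlow_shift_sub hw q' s (hqsT s hs)
    rw [← haq] at h1 h2
    exact ⟨h1, by rw [h2, hY, realFlowStop_of_lt (hqsT s hs)]⟩
  -- `w − o > x/2` on `[q', b)`
  have hZ : ∀ u : ℝ≥0, q' ≤ u → u < b → x / 2 < w u - o u := by
    intro u hqu hub
    have huT : (u : WithTop ℝ≥0) < swallowingTime w x := by rw [← hb]; exact_mod_cast hub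
    have h1 : x ≤ (map w u x).re := by
      have := re_map_mono hw hx0 zero_le huT
      rwa [map_zero_apply hw hx', ofReal_re] at this
    have h2 : Y u < x / 2 := hsmall u (ht₁q.trans_le hqu) hub.le
    have h3 : Y u = (map w u x).re - w u := by rw [hY, realFlowStop_of_lt huT, realFlow]
    linarith [ho u]
  -- the difference `V − U` is non-decreasing on `[0, τ₀)`
  set f : ℝ → ℝ := fun u ↦ (w u.toNNReal - o u.toNNReal)⁻¹ with hf
  have hD : MonotoneOn (fun s : ℝ≥0 ↦ V s - U s) (Iio τ₀) := by
    intro s₁ hs₁ s₂ hs₂ h12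
    have hs₂b : q' + s₂ < b := hqs s₂ hs₂
    -- the increment of `∫ du/(w − o)` over `[q' + s₁, q' + s₂]`
    have hle : ((q' + s₁ : ℝ≥0) : ℝ) ≤ ((q' + s₂ : ℝ≥0) : ℝ) := by
      exact_mod_cast (add_le_add le_rfl h12 : q' + s₁ ≤ q' + s₂)
    have hsub : (∫ u in (0 : ℝ)..((q' + s₂ : ℝ≥0) : ℝ), f u) -
        ∫ u in (0 : ℝ)..((q' + s₁ : ℝ≥0) : ℝ), f u =
        ∫ u in ((q' + s₁ : ℝ≥0) : ℝ)..((q' + s₂ : ℝ≥0) : ℝ), f u :=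
      intervalIntegral.integral_interval_sub_left (hint _) (hint _)
    have hbound : ∀ u ∈ Icc ((q' + s₁ : ℝ≥0) : ℝ) ((q' + s₂ : ℝ≥0) : ℝ),
        0 ≤ f u ∧ f u ≤ 2 / x := by
      intro u hu
      have hu0 : 0 ≤ u := le_trans (by positivity) hu.1
      have hqu : q' ≤ u.toNNReal := by
        rw [← NNReal.coe_le_coe, Real.coe_toNNReal _ hu0]
        exact le_trans (by push_cast; linarith [s₁.coe_nonneg]) hu.1
      have hub : u.toNNReal < b := by
        rw [← NNReal.coe_lt_coe, Real.coe_toNNReal _ hu0]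
        exact lt_of_le_of_lt hu.2 (by exact_mod_cast hs₂b)
      have hz := hZ _ hqu hub
      have hzpos : 0 < w u.toNNReal - o u.toNNReal := lt_trans (by positivity) hz
      refine ⟨inv_nonneg.2 hzpos.le, ?_⟩
      rw [hf]
      calc (w u.toNNReal - o u.toNNReal)⁻¹ ≤ (x / 2)⁻¹ := inv_anti₀ (by positivity) hz.le
        _ = 2 / x := by rw [inv_div]
    have hJ0 : 0 ≤ ∫ u in ((q' + s₁ : ℝ≥0) : ℝ)..((q' + s₂ : ℝ≥0) : ℝ), f u :=
      intervalIntegral.integral_nonneg hle fun u hu ↦ (hbound u hu).1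
    have hJle : (∫ u in ((q' + s₁ : ℝ≥0) : ℝ)..((q' + s₂ : ℝ≥0) : ℝ), f u) ≤
        2 / x * ((s₂ : ℝ) - s₁) := by
      have hfi : IntervalIntegrable f volume ((q' + s₁ : ℝ≥0) : ℝ) ((q' + s₂ : ℝ≥0) : ℝ) :=
        (hint _).symm.trans (hint _)
      calc (∫ u in ((q' + s₁ : ℝ≥0) : ℝ)..((q' + s₂ : ℝ≥0) : ℝ), f u)
          ≤ ∫ _ in ((q' + s₁ : ℝ≥0) : ℝ)..((q' + s₂ : ℝ≥0) : ℝ), 2 / x :=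
            intervalIntegral.integral_mono_on hle hfi intervalIntegrable_const
              fun u hu ↦ (hbound u hu).2
        _ = 2 / x * ((s₂ : ℝ) - s₁) := by
            rw [intervalIntegral.integral_const, smul_eq_mul]
            push_cast
            ring
    -- `ρ` times the increment is at most `c (s₂ − s₁)`
    have hρJ : ρ * ∫ u in ((q' + s₁ : ℝ≥0) : ℝ)..((q' + s₂ : ℝ≥0) : ℝ), f u ≤
        2 * max ρ 0 / x * ((s₂ : ℝ) - s₁) :=
      calc ρ * ∫ u in ((q' + s₁ : ℝ≥0) : ℝ)..((q' + s₂ : ℝ≥0) : ℝ), f u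
          ≤ max ρ 0 * ∫ u in ((q' + s₁ : ℝ≥0) : ℝ)..((q' + s₂ : ℝ≥0) : ℝ), f u :=
            mul_le_mul_of_nonneg_right (le_max_left ρ 0) hJ0
        _ ≤ max ρ 0 * (2 / x * ((s₂ : ℝ) - s₁)) :=
            mul_le_mul_of_nonneg_left hJle (le_max_right ρ 0)
        _ = 2 * max ρ 0 / x * ((s₂ : ℝ) - s₁) := by ring
    -- conclusion
    have key : ρ * (∫ u in (0 : ℝ)..((q' + s₂ : ℝ≥0) : ℝ), f u) -
        ρ * ∫ u in (0 : ℝ)..((q' + s₁ : ℝ≥0) : ℝ), f u ≤ 2 * max ρ 0 / x * ((s₂ : ℝ) - s₁) := by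
      rw [← mul_sub, hsub]
      exact hρJ
    show V s₁ - U s₁ ≤ V s₂ - U s₂
    simp only [hU, hV]
    rw [hweq (q' + s₁), hweq (q' + s₂)]
    linarith [key]
  -- the `U`-gap tends to `0` at `τ₀−`
  have hlim : Tendsto (fun s ↦ realFlow U a s) (𝓝[<] τ₀) (𝓝 0) := by
    have h1 : Tendsto (fun s : ℝ≥0 ↦ Y (q' + s)) (𝓝 τ₀) (𝓝 (Y (q' + τ₀))) :=
      (hYc.comp (continuous_const.add continuous_id)).tendsto τ₀
    have h2 : Y (q' + τ₀) = 0 := by rw [hτ₀, add_tsub_cancel_of_le hqb.le, hYb]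
    rw [h2] at h1
    refine (h1.mono_left nhdsWithin_le_nhds).congr' ?_
    filter_upwards [self_mem_nhdsWithin] with s hs
    exact ((hcoc s hs).2).symm
  exact realFlow_not_tendsto_zero_of_comparison hUc hVc hU0 hV0 hapos hτ₀pos
    (fun s hs ↦ (hcoc s hs).1) (by rw [hVtop]; exact WithTop.coe_lt_top _) hD hlim

end Loewner

/-! ### Discharge of the named fact -/

open Literature.Probability.Process (preWienerMeasure brownian continuous_brownian)
open Literature.Analysis.FunctionSpaces (IsBesselProcess)

/-- **[LSW] Lemma 8.3 (2) on the positive axis holds** (discharge of the named fact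
`SLEKappaRho.swallowingTime_ofReal_pos`, [LSW] p. 36: "a.s. `1 ∉ K_t` for all `t ≥ 0` […]
Scale invariance then implies `K_∞ ∩ (0, ∞) = ∅` a.s."): for `0 < κ ≤ 4`, `ρ > −2` and an
SLE(κ, ρ) driving pair `(O, W)`, almost surely no real `x > 0` is ever swallowed by the Loewner
chain of `t ↦ W_t(ω)`. Almost every sample path satisfies the hypotheses of the pathwise core
`Loewner.swallowingTime_eq_top_of_drift_comparison`: `W(ω)` is continuous with `W_0 = 0`,
`u ↦ 1/Z_u` is locally integrable and `W_t = √κ B_t + ρ ∫₀ᵗ du/Z_u` ([LSW] §8.3,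
`SLEKappaRho.integral_inv_eq_holds`, `IsSLEKappaRhoPair.ae_continuous`,
`SLEKappaRho.ae_snd_eq_of`), `O_t = −2 ∫₀ᵗ du/(√κ X_u) ≤ 0`, and for the countably many rational
shifts `q` no positive point is swallowed by `s ↦ √κ (B_{q+s} − B_q) + c s`
(`ae_forall_swallowingTime_shift_add_mul_eq_top` with
`sle_drift_swallowingTime_ofReal_eq_top_holds`, the Cameron–Martin sentence of the printed
proof); this gives `T_x = ∞` a.s. for each level `x = 1/(n+1)`, hence for all `x > 0` at once by
monotonicity of `T_x` in `x` (`Loewner.forall_swallowingTime_eq_top_of_seq`, [LSW]: "Scale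
invariance then implies `K_∞ ∩ (0, ∞) = ∅`").
[cite: LawlerSchrammWerner2003Restriction, Lemma 8.3 (2)–(3) and their proof (p. 36: K_∞ ∩ (0, ∞) = ∅ a.s.)] -/
theorem SLEKappaRho.swallowingTime_ofReal_pos_holds : SLEKappaRho.swallowingTime_ofReal_pos := by
  intro κ ρ O W hκ hκ4 hρ hOW
  -- facts valid on every sample path
  have hW0 : ∀ ω, W 0 ω = 0 := hOW.snd_zero
  have hO : ∀ t ω, O t ω ≤ 0 := by
    obtain ⟨X, hX, hO, -⟩ := hOW
    intro t ω
    rw [hO t ω]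
    have : 0 ≤ ∫ u in (0 : ℝ)..(t : ℝ), (Real.sqrt κ * X u.toNNReal ω)⁻¹ :=
      intervalIntegral.integral_nonneg t.coe_nonneg fun u _ ↦
        inv_nonneg.2 (mul_nonneg (Real.sqrt_nonneg _) (hX.nonneg _ _))
    linarith
  -- almost sure facts: the integrated Bessel equation, `W = √κ B + ρ ∫ du/Z`, continuity
  have h1 := SLEKappaRho.integral_inv_eq_holds hκ hρ hOW
  have h2 := SLEKappaRho.ae_snd_eq_of SLEKappaRho.integral_inv_eq_holds hκ hρ hOW
  have h3 := hOW.ae_continuous SLEKappaRho.integral_inv_eq_holds hκ hρ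
  -- the drifted non-swallowing at all rational shifts, for the drift of each level `1/(n+1)`
  have h4 : ∀ᵐ ω ∂preWienerMeasure, ∀ n : ℕ, ∀ q : ℚ, ∀ a : ℝ, 0 < a →
      Loewner.swallowingTime (fun s : ℝ≥0 ↦ sleDriving κ ω (((q : ℝ)).toNNReal + s) -
        sleDriving κ ω ((q : ℝ)).toNNReal +
          2 * max ρ 0 / (1 / ((n : ℝ) + 1)) * (s : ℝ)) a = ⊤ := by
    rw [ae_all_iff]
    intro n
    rw [ae_all_iff]
    intro q
    exact ae_forall_swallowingTime_shift_add_mul_eq_top sle_drift_swallowingTime_ofReal_eq_top_holds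
      hκ hκ4 _ _
  filter_upwards [h1, h2, h3, h4] with ω hI hWeq hc hdr x hx
  refine Loewner.forall_swallowingTime_eq_top_of_seq hc.1 (hW0 ω) (fun n ↦ ?_) hx
  exact Loewner.swallowingTime_eq_top_of_drift_comparison (β := fun t ↦ brownian t ω)
    (o := fun t ↦ O t ω) (κ := (κ : ℝ)) (ρ := ρ) hc.1 (hW0 ω) (continuous_brownian ω)
    (fun t ↦ hO t ω) (by positivity) (fun t ↦ (hI t).1) (fun t ↦ hWeq t)
    (fun q _ a ha ↦ hdr n q a ha)

end Literature.Probability.RandomPlanarGeometry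

end
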